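import Mathlib
import Summits.Ventures.PercRepro2.RowC1RowPlusSigns

/-!
# The sharper row (ROW+) and its covariance decomposition (blind cell PercRepro2, p2 g32;
proofs/P2-G32-STAR.md §12)

With `Q = {a₁ ↮ a₂}`, `L = C(a₁)`, `H = C(a₂)`, `oL = {o ∈ L}`, `oH = {o ∈ H}`, `oN = Q ∖ (oL ∪ oH)`:

  **(ROW+)**  `μ(b ∈ H | o rootless) ≤ μ(b ∈ H) + μ(o ∈ L, b ∈ L)`, i.e.
  `P(Q, oN, bH)·P(Q) ≤ P(Q, oN)·P(Q, bH) + P(Q, oL, bL)·P(Q, oN)`   (`RowPlus`, a CONJECTURE of the cell),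

which implies row 2′C1 (`c1_of_rowPlus`: the row is `Cov_μ(oN, bH) ≤ μ(oU, bL)` and
`μ(oL, bL)·μ(oN) ≤ μ(oU, bL)`).  Decomposition (`rowPlus_iff`): (ROW+) ⟺ `R₂ᴴ ≤ P(Q,oN)·P(Q,oL,bL) + A₁ᴴ`
with the repulsion `R₂ᴴ = P(Q,oL)P(Q,oN,bH) − P(Q,oN)P(Q,oL,bH) ≥ 0` (`repulsionH_nonneg`, from
`condH_oL_le_oN`) and the attraction `A₁ᴴ = P(Q,oN)P(Q,oH,bH) − P(Q,oH)P(Q,oN,bH) ≥ 0`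
(`attractionH_nonneg`, from `condH_oH_ge_oN`).  Std axioms.
-/

namespace Summit.Ventures.PercRepro2

namespace RowC1

section RowPlus

open Classical

variable {V : Type*} {E : Type*} [Fintype E] [DecidableEq E] [Fintype V] [DecidableEq V]
  {R : Type*} [CommRing R] [LinearOrder R] [IsStrictOrderedRing R]

/-! ### (ROW+) and its decomposition -/

/-- **(ROW+)**: `P(Q, oN, b ∈ H) · P(Q) ≤ P(Q, oN) · P(Q, b ∈ H) + P(Q, oL, b ∈ L) · P(Q, oN)`, i.e.
`μ(b ∈ H | o rootless) ≤ μ(b ∈ H) + μ(o ∈ L, b ∈ L)` — a CONJECTURE of the cell sharpening row 2′C1. -/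
def RowPlus (p : E → R) (ends : E → Sym2 V) (a₁ a₂ o b : V) : Prop :=
  prob p ((connEvent ends a₁ o ∪ connEvent ends a₂ o)ᶜ ∩ connEvent ends a₂ b ∩
      (connEvent ends a₁ a₂)ᶜ) * prob p (connEvent ends a₁ a₂)ᶜ ≤
    prob p ((connEvent ends a₁ o ∪ connEvent ends a₂ o)ᶜ ∩ (connEvent ends a₁ a₂)ᶜ) *
        prob p (connEvent ends a₂ b ∩ (connEvent ends a₁ a₂)ᶜ) +
      prob p (connEvent ends a₁ o ∩ connEvent ends a₁ b ∩ (connEvent ends a₁ a₂)ᶜ) *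
        prob p ((connEvent ends a₁ o ∪ connEvent ends a₂ o)ᶜ ∩ (connEvent ends a₁ a₂)ᶜ)

omit [Fintype E] [DecidableEq E] [Fintype V] [DecidableEq V] in
/-- On `Q`, `b ∈ L` and `b ∈ H` are exclusive. -/
lemma not_bL_bH {ends : E → Sym2 V} {ω : Config E} {a₁ a₂ b : V}
    (h₁ : ω ∈ connEvent ends a₁ b) (h₂ : ω ∈ connEvent ends a₂ b) : ω ∉ (connEvent ends a₁ a₂)ᶜ :=
  fun hQ => hQ (conn_trans h₁ (conn_symm h₂))

omit [Fintype V] [DecidableEq V] in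
/-- **Row 2′C1 from (ROW+)** (the conclusion of `c1_of_lpart`, verbatim). -/
theorem c1_of_rowPlus (p : E → R) (hp : IsProbVec p) (ends : E → Sym2 V) (a₁ a₂ o b : V)
    (hR : RowPlus p ends a₁ a₂ o b) :
    prob p (connEvent ends a₂ b ∩ (connEvent ends a₁ a₂)ᶜ) *
      prob p ((connEvent ends a₁ o ∪ connEvent ends a₂ o) ∩ (connEvent ends a₁ a₂)ᶜ) ≤
    prob p (connEvent ends a₁ a₂)ᶜ *
      prob p ((connEvent ends a₁ o ∪ connEvent ends a₂ o) ∩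
        (connEvent ends a₁ b ∪ connEvent ends a₂ b) ∩ (connEvent ends a₁ a₂)ᶜ) := by
  unfold RowPlus at hR
  set Q : Set (Config E) := (connEvent ends a₁ a₂)ᶜ with hQ
  set oU : Set (Config E) := connEvent ends a₁ o ∪ connEvent ends a₂ o with hoU
  set bH : Set (Config E) := connEvent ends a₂ b with hbH
  set bL : Set (Config E) := connEvent ends a₁ b with hbL
  -- partitions
  have p1 := prob_inter_add_prob_inter_compl p Q oU
  have p2 := prob_inter_add_prob_inter_compl p (bH ∩ Q) oU
  have p3 := prob_inter_add_prob_inter_compl p (oU ∩ Q) bH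
  have s1 : Q ∩ oU = oU ∩ Q := Set.inter_comm _ _
  have s2 : Q ∩ oUᶜ = oUᶜ ∩ Q := Set.inter_comm _ _
  have s3 : bH ∩ Q ∩ oU = bH ∩ oU ∩ Q := by
    ext ω; simp only [Set.mem_inter_iff]; tauto
  have s4 : bH ∩ Q ∩ oUᶜ = oUᶜ ∩ bH ∩ Q := by
    ext ω; simp only [Set.mem_inter_iff, Set.mem_compl_iff]; tauto
  have s5 : oU ∩ Q ∩ bH = bH ∩ oU ∩ Q := by
    ext ω; simp only [Set.mem_inter_iff]; tauto
  rw [s1, s2] at p1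
  rw [s3, s4] at p2
  rw [s5] at p3
  -- `oU ∩ bU ∩ Q = (bH ∩ oU ∩ Q) ⊔ (oU ∩ bL ∩ Q)` and `oL ∩ bL ∩ Q ⊆ oU ∩ bL ∩ Q`
  have hsplit : prob p (oU ∩ (bL ∪ bH) ∩ Q) = prob p (bH ∩ oU ∩ Q) + prob p (oU ∩ bL ∩ Q) := by
    rw [← prob_union_of_disjoint]
    · congr 1
      ext ω
      simp only [Set.mem_inter_iff, Set.mem_union]
      tauto
    · rw [Set.disjoint_left]
      rintro ω ⟨⟨h2, _⟩, hQ⟩ ⟨⟨_, h1⟩, _⟩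
      exact not_bL_bH h1 h2 hQ
  have hsub : prob p (connEvent ends a₁ o ∩ bL ∩ Q) ≤ prob p (oU ∩ bL ∩ Q) :=
    prob_mono hp (by
      rintro ω ⟨⟨h1, h2⟩, h3⟩
      exact ⟨⟨Or.inl h1, h2⟩, h3⟩)
  have hmono : prob p (oUᶜ ∩ Q) ≤ prob p Q := prob_mono hp Set.inter_subset_right
  have hn1 : 0 ≤ prob p (connEvent ends a₁ o ∩ bL ∩ Q) := prob_nonneg hp _
  have hn2 : 0 ≤ prob p (oUᶜ ∩ Q) := prob_nonneg hp _
  have hn3 : 0 ≤ prob p (oU ∩ Q) := prob_nonneg hp _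
  have hprod : prob p (connEvent ends a₁ o ∩ bL ∩ Q) * prob p (oUᶜ ∩ Q) ≤
      prob p (oU ∩ bL ∩ Q) * prob p Q := mul_le_mul hsub hmono hn2 (prob_nonneg hp _)
  rw [hsplit]
  have e1 : prob p (bH ∩ Q) * prob p (oU ∩ Q) =
      prob p (bH ∩ Q) * prob p Q - prob p (bH ∩ Q) * prob p (oUᶜ ∩ Q) := by
    rw [← p1]; ring
  have e2 : prob p Q * prob p (bH ∩ oU ∩ Q) =
      prob p Q * prob p (bH ∩ Q) - prob p Q * prob p (oUᶜ ∩ bH ∩ Q) := by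
    rw [← p2]; ring
  nlinarith [hR, e1, e2, hprod, hn3]

omit [Fintype E] [DecidableEq E] [Fintype V] [DecidableEq V] in
/-- On `Q`, `o ∈ L` and `o ∈ H` are exclusive. -/
lemma not_oL_oH_rp {ends : E → Sym2 V} {ω : Config E} {a₁ a₂ o : V}
    (h₁ : ω ∈ connEvent ends a₁ o) (h₂ : ω ∈ connEvent ends a₂ o) : ω ∉ (connEvent ends a₁ a₂)ᶜ :=
  fun hQ => hQ (conn_trans h₁ (conn_symm h₂))

omit [Fintype V] [DecidableEq V] [LinearOrder R] [IsStrictOrderedRing R] in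
/-- `P(Q, o ∈ U, A) = P(Q, o ∈ L, A) + P(Q, o ∈ H, A)` for every event `A`. -/
lemma prob_oU_split_rp (p : E → R) (ends : E → Sym2 V) (a₁ a₂ o : V) (A : Set (Config E)) :
    prob p ((connEvent ends a₁ o ∪ connEvent ends a₂ o) ∩ A ∩ (connEvent ends a₁ a₂)ᶜ) =
      prob p (connEvent ends a₁ o ∩ A ∩ (connEvent ends a₁ a₂)ᶜ) +
        prob p (connEvent ends a₂ o ∩ A ∩ (connEvent ends a₁ a₂)ᶜ) := by
  rw [← prob_union_of_disjoint]
  · congr 1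
    ext ω
    simp only [Set.mem_inter_iff, Set.mem_union]
    tauto
  · rw [Set.disjoint_left]
    rintro ω ⟨⟨h₁, _⟩, hQ⟩ ⟨⟨h₂, _⟩, _⟩
    exact not_oL_oH_rp h₁ h₂ hQ

omit [Fintype V] [DecidableEq V] [LinearOrder R] [IsStrictOrderedRing R] in
/-- `P(Q, o ∈ U) = P(Q, o ∈ L) + P(Q, o ∈ H)`. -/
lemma prob_oU_split_rp' (p : E → R) (ends : E → Sym2 V) (a₁ a₂ o : V) :
    prob p ((connEvent ends a₁ o ∪ connEvent ends a₂ o) ∩ (connEvent ends a₁ a₂)ᶜ) =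
      prob p (connEvent ends a₁ o ∩ (connEvent ends a₁ a₂)ᶜ) +
        prob p (connEvent ends a₂ o ∩ (connEvent ends a₁ a₂)ᶜ) := by
  have h := prob_oU_split_rp p ends a₁ a₂ o Set.univ
  simpa only [Set.inter_univ] using h

omit [Fintype V] [DecidableEq V] in
/-- **(ROW+) ⟺ repulsion ≤ type-II mass + attraction**, with
`R₂ᴴ = P(Q,oL)P(Q,oN,bH) − P(Q,oN)P(Q,oL,bH)`, `A₁ᴴ = P(Q,oN)P(Q,oH,bH) − P(Q,oH)P(Q,oN,bH)` and the
type-II mass `P(Q,oN)·P(Q,oL,bL)`. -/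
theorem rowPlus_iff (p : E → R) (ends : E → Sym2 V) (a₁ a₂ o b : V) :
    RowPlus p ends a₁ a₂ o b ↔
    prob p (connEvent ends a₁ o ∩ (connEvent ends a₁ a₂)ᶜ) *
        prob p ((connEvent ends a₁ o ∪ connEvent ends a₂ o)ᶜ ∩ connEvent ends a₂ b ∩
          (connEvent ends a₁ a₂)ᶜ) -
      prob p ((connEvent ends a₁ o ∪ connEvent ends a₂ o)ᶜ ∩ (connEvent ends a₁ a₂)ᶜ) *
        prob p (connEvent ends a₁ o ∩ connEvent ends a₂ b ∩ (connEvent ends a₁ a₂)ᶜ) ≤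
    prob p ((connEvent ends a₁ o ∪ connEvent ends a₂ o)ᶜ ∩ (connEvent ends a₁ a₂)ᶜ) *
        prob p (connEvent ends a₁ o ∩ connEvent ends a₁ b ∩ (connEvent ends a₁ a₂)ᶜ) +
      (prob p ((connEvent ends a₁ o ∪ connEvent ends a₂ o)ᶜ ∩ (connEvent ends a₁ a₂)ᶜ) *
          prob p (connEvent ends a₂ o ∩ connEvent ends a₂ b ∩ (connEvent ends a₁ a₂)ᶜ) -
        prob p (connEvent ends a₂ o ∩ (connEvent ends a₁ a₂)ᶜ) *
          prob p ((connEvent ends a₁ o ∪ connEvent ends a₂ o)ᶜ ∩ connEvent ends a₂ b ∩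
            (connEvent ends a₁ a₂)ᶜ)) := by
  unfold RowPlus
  -- `P(Q) = P(Q, oL) + P(Q, oH) + P(Q, oN)` and `P(Q, bH) = P(Q, oL, bH) + P(Q, oH, bH) + P(Q, oN, bH)`
  have q1 := prob_inter_add_prob_inter_compl p (connEvent ends a₁ a₂)ᶜ
    (connEvent ends a₁ o ∪ connEvent ends a₂ o)
  have q2 := prob_oU_split_rp' p ends a₁ a₂ o
  have q3 := prob_inter_add_prob_inter_compl p (connEvent ends a₂ b ∩ (connEvent ends a₁ a₂)ᶜ)
    (connEvent ends a₁ o ∪ connEvent ends a₂ o)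
  have q4 := prob_oU_split_rp p ends a₁ a₂ o (connEvent ends a₂ b)
  have s1 : (connEvent ends a₁ a₂)ᶜ ∩ (connEvent ends a₁ o ∪ connEvent ends a₂ o) =
      (connEvent ends a₁ o ∪ connEvent ends a₂ o) ∩ (connEvent ends a₁ a₂)ᶜ := Set.inter_comm _ _
  have s2 : (connEvent ends a₁ a₂)ᶜ ∩ (connEvent ends a₁ o ∪ connEvent ends a₂ o)ᶜ =
      (connEvent ends a₁ o ∪ connEvent ends a₂ o)ᶜ ∩ (connEvent ends a₁ a₂)ᶜ := Set.inter_comm _ _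
  have s3 : connEvent ends a₂ b ∩ (connEvent ends a₁ a₂)ᶜ ∩ (connEvent ends a₁ o ∪ connEvent ends a₂ o) =
      (connEvent ends a₁ o ∪ connEvent ends a₂ o) ∩ connEvent ends a₂ b ∩ (connEvent ends a₁ a₂)ᶜ := by
    ext ω; simp only [Set.mem_inter_iff]; tauto
  have s4 : connEvent ends a₂ b ∩ (connEvent ends a₁ a₂)ᶜ ∩ (connEvent ends a₁ o ∪ connEvent ends a₂ o)ᶜ =
      (connEvent ends a₁ o ∪ connEvent ends a₂ o)ᶜ ∩ connEvent ends a₂ b ∩ (connEvent ends a₁ a₂)ᶜ := by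
    ext ω; simp only [Set.mem_inter_iff, Set.mem_compl_iff]; tauto
  rw [s1, s2, q2] at q1
  rw [s3, s4, q4] at q3
  rw [← q1, ← q3]
  constructor
  · intro h
    nlinarith [h]
  · intro h
    nlinarith [h]

/-- The repulsion of (ROW+) is nonnegative (restatement of `condH_oL_le_oN`). -/
theorem repulsionH_nonneg (p : E → R) (hp : IsProbVec p) (ends : E → Sym2 V) (a₁ a₂ o b : V) :
    0 ≤ prob p (connEvent ends a₁ o ∩ (connEvent ends a₁ a₂)ᶜ) *
        prob p ((connEvent ends a₁ o ∪ connEvent ends a₂ o)ᶜ ∩ connEvent ends a₂ b ∩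
          (connEvent ends a₁ a₂)ᶜ) -
      prob p ((connEvent ends a₁ o ∪ connEvent ends a₂ o)ᶜ ∩ (connEvent ends a₁ a₂)ᶜ) *
        prob p (connEvent ends a₁ o ∩ connEvent ends a₂ b ∩ (connEvent ends a₁ a₂)ᶜ) := by
  have h := condH_oL_le_oN p hp ends a₁ a₂ o b
  linarith [h]

/-- The attraction of (ROW+) is nonnegative (restatement of `condH_oH_ge_oN`). -/
theorem attractionH_nonneg (p : E → R) (hp : IsProbVec p) (ends : E → Sym2 V) (a₁ a₂ o b : V) :
    0 ≤ prob p ((connEvent ends a₁ o ∪ connEvent ends a₂ o)ᶜ ∩ (connEvent ends a₁ a₂)ᶜ) *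
          prob p (connEvent ends a₂ o ∩ connEvent ends a₂ b ∩ (connEvent ends a₁ a₂)ᶜ) -
        prob p (connEvent ends a₂ o ∩ (connEvent ends a₁ a₂)ᶜ) *
          prob p ((connEvent ends a₁ o ∪ connEvent ends a₂ o)ᶜ ∩ connEvent ends a₂ b ∩
            (connEvent ends a₁ a₂)ᶜ) := by
  have h := condH_oH_ge_oN p hp ends a₁ a₂ o b
  linarith [h]

/-! ## ERRATUM (p2 g32, 2026-08-29T15:46Z, kit j333095)

**`RowPlus` is FALSE in general**: ratio-maximising descents with exact re-check found 133 / 4,429 exact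
violations at n 5–7 and 33 / 1,379 at n = 8 (all at extreme corners, slacks 10⁻¹¹ … 10⁻¹⁴, float ratios up
to 1.95); an independent exact re-evaluation of the witness n = 8, edges 67 17 26 27 56 01 45 34 07 06,
w = (19/20, 999/1000, 19/20, 49/50, 999/1000, 999/1000, 1/20, 9/10, 1/10, 1/1000), marks (a₁,a₂,o,b) =
(2,1,5,0) gives `lhs − rhs = +2.46·10⁻¹²` (ratio 1.435) while row 2′C1 holds there (slack 2.8·10⁻¹⁰).
The declarations above stand as stated: `c1_of_rowPlus` and `rowPlus_iff` are implications / an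
equivalence with a hypothesis that is false for some weights, and the two signs `condH_oL_le_oN`,
`condH_oH_ge_oN` (RowC1RowPlusSigns.lean) are unconditional theorems.  The row's true sharpening of
this shape therefore needs the factor `1/μ(oN)` (the row itself: `Cov_μ(oN, bH) ≤ μ(oU, bL)`), not
`μ(oL, bL)·μ(oN)`.  Data: data/p2/g32/j333095/.
-/

end RowPlus

end RowC1

end Summit.Ventures.PercRepro2
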